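import Literature.NumberTheory.Automorphic.Liu2021.AlbaneseBaseChangeProduct
import Literature.AlgebraicGeometry.Motives.AlbaneseExistenceSubfieldComplex
import HarnessLib

/-!
# Liu 2021 §2.1: the Albanese datum of a scheme split over a subfield of `ℂ` exists

Topic `Literature/NumberTheory/Automorphic/Liu2021`, sequel of `Liu2021/AlbaneseBaseChangeProduct`
(`AppendixC.Albanese.exists_of_isColimit`: Liu's Albanese datum (Def. 2.3) of a scheme split into geometrically
irreducible pieces carrying Milne's point-free Albanese data, over ANY field) and of
`Motives/AlbaneseExistenceSubfieldComplex` (`nonempty_jacobian_of_isSmoothProjective_of_algebra_complex`: every smooth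
projective geometrically irreducible variety over a field `k ⊆ ℂ` has such a datum, point-free, any dimension).
PROOF FILE: theorems only — no definition, no named fact, sorry-free (D-0026).

* `AppendixC.Albanese.nonempty_of_isColimit_of_algebra_complex` — for a field `k ⊆ ℂ` and a finite colimit cofan
  `inj_c : Y_c ⟶ X` of smooth projective geometrically irreducible `k`-schemes `Y_c` (any dimensions `d c`),
  `Nonempty (AppendixC.Albanese X)`: [Liu2021, §2.1 Proposition] for `X` SPLIT over `k`.
* `AppendixC.Albanese.nonempty_of_isSmoothProjective_of_algebra_complex` — the one-piece case: every smooth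
  projective geometrically irreducible `X / k`, `k ⊆ ℂ`, has a Liu Albanese datum (with `∇X = X × X`).

What this does NOT give: the Proposition for a smooth projective `X / k` whose connected components are NOT
geometrically irreducible (Liu's `X_K` over the reflex field in general) — that needs the splitting of `X ⊗_k k'`
over a finite Galois `k'` and the Galois descent of the `∇`-datum (l. 1194–1200, «the statement for `X` then follows
by Galois descent»), not in the tree; nor `exists_albanese` in its typed generality (all fields, proper `X`).
Relies on: nothing unproved (axioms `propext`, `Classical.choice`, `Quot.sound`).

## References

* [Liu2021] Y. Liu, *Fourier–Jacobi cycles and arithmetic relative trace formula*, Camb. J. Math. 9 (2021) =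
  arXiv:2102.11518: §2.1 Def. 2.1 (1) (FJcycle.tex l. 1171–1174), Proposition (l. 1190–1192) with proof
  (l. 1194–1200), Def. 2.3 (l. 1202–1208).
* [Milne1986JacobianVarieties] J. S. Milne, *Jacobian Varieties* (1986), §6 Prop. 6.4, Remark 6.5.
* [Serre1958MorphismesUniversels] J.-P. Serre, *Morphismes universels et variété d'Albanese* (1958/59), exp. 10.
-/

noncomputable section

open CategoryTheory CategoryTheory.Limits AlgebraicGeometry
open Literature.AlgebraicGeometry.Motives

namespace Literature.NumberTheory.Automorphic.Liu2021.AppendixC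

universe v

variable {k : Type} [Field k] [Algebra k ℂ]

/-- **[Liu2021, §2.1, Proposition] for a scheme SPLIT over a subfield of `ℂ`.**  For a field `k ⊆ ℂ` and a finite
colimit cofan `inj_c : Y_c ⟶ X` (`X ≅ ∐_c Y_c`) of smooth projective geometrically irreducible `k`-schemes `Y_c`, of any
dimensions, `X` carries an Albanese datum in the sense of Def. 2.3 (`∇X → Alb_X` corepresenting
`A ↦ {f : ∇X → A | ΔX ⊆ f⁻¹0_A}`): each piece has Milne's point-free Albanese datum over `k`
(`Motives.nonempty_jacobian_of_isSmoothProjective_of_algebra_complex`: Serre's criterion, the complex bound transported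
by base change, Galois descent of the abstract datum), and `Albanese.exists_of_isColimit` assembles them
(`∇X = ∐_c Y_c × Y_c`, `Alb_X = ∏_c Alb_{Y_c}`, l. 1194–1200).  Ours.
[cite: Liu2021, §2.1 Proposition (l. 1190–1192) with proof (l. 1194–1200), Def. 2.3 (l. 1202–1208)]
[cite: Milne1986JacobianVarieties, §6 Prop. 6.4, Remark 6.5] -/
theorem Albanese.nonempty_of_isColimit_of_algebra_complex {X : SchemeOver k} {κ : Type v} [Small.{0} κ]
    [Fintype κ] {Y : κ → SchemeOver k} {inj : ∀ c, Y c ⟶ X} (hcol : IsColimit (Cofan.mk X inj))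
    {d : κ → ℕ} (hY : ∀ c, IsSmoothProjective (d c) (Y c)) : Nonempty (Albanese X) :=
  Albanese.nonempty_of_isColimit hcol
    (fun c => (nonempty_jacobian_of_isSmoothProjective_of_algebra_complex (hY c)).some)
    fun c => (hY c).geometricallyIrreducible

/-- **[Liu2021, §2.1, Proposition] for a geometrically irreducible smooth projective variety over a subfield of `ℂ`**
(one piece: `∇X = X × X`, `Alb_X` = Milne's point-free Albanese variety of `X`).  Ours.
[cite: Liu2021, §2.1 Proposition (l. 1190–1192), Def. 2.3 (l. 1202–1208)] [cite: Milne1986JacobianVarieties, §6 Remark 6.5] -/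
theorem Albanese.nonempty_of_isSmoothProjective_of_algebra_complex {d : ℕ} (X : SchemeOver k)
    (hX : IsSmoothProjective d X) : Nonempty (Albanese X) :=
  Albanese.nonempty_of_isColimit_of_algebra_complex (κ := PUnit.{1}) (Y := fun _ => X) (inj := fun _ => 𝟙 X)
    (Cofan.IsColimit.mk _ (fun s => s.inj PUnit.unit) (fun _ ⟨⟩ => Category.id_comp _)
      (fun _ m hm => (Category.id_comp m).symm.trans (hm PUnit.unit)))
    (d := fun _ => d) fun _ => hX

end Literature.NumberTheory.Automorphic.Liu2021.AppendixC

end
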